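import Mathlib
import Summits.NavierStokesRegularity.NavierStokesRegularity.Theorems.TypeIQuarterGateScarEnvelopeTypeISatelliteTowerEnvelopeConst
import Summits.NavierStokesRegularity.NavierStokesRegularity.Theorems.TypeIQuarterGateScarEnvelopeTypeIBudgetCompactnessEventual

/-!
# Satellite tower for crux `ScarEnvelopeTypeI` (stmt-NavierStokesRegularity-23843) — Part V0–V2: ENERGY SATURATION AT SCARS (no energy defect for doubly-minimal objects)

Part V0–V2 of nsreg-p3's ROUND-41 artefact (section `EnergySaturation`): V0 `abSeq_closed''` (T1 with the cylinder-energy clause of T0 exported raw);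
V1 `ExactCrit.minLevel_le_local` / `ExactCrit.minLevel_le_root` (for an exactly-critical object the Type-I energy of EVERY cylinder `Q_ρ((0,y'))` at a
scar is `≥ minLevel I`); V2 ★★ `DoublyMin.energy_local_eq` / `DoublyMin.energy_root_eq` / `DoublyMin.energy_local_eq_level` (for a DOUBLY-MINIMAL object
and EVERY scar and EVERY `ρ > 0`: `𝐈(Q_ρ((0,y'))) = 𝐈(n) = minLevel I` exactly — no energy defect), `DoublyMin.exists_cylinder`.

PROVENANCE: declaration texts VERBATIM from the HOME artefact of the instrument seat nsreg-p3 g27 (cell `pub/ns-regularity-ideate`):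
`round-41/Sat41.lean` (sha16 `1f5462a3478ca76f`, NEW part `partV.lean` 86a90bef12d2219d; a module written against the TREE;
memo `round-41/ROUND-41.md`), scored PASS ★★ by referee ref3 g27 (`SCORE-p3-ROUND-41-0828.md` 2acea5ffdf77f685); the author cannot write under `Theorems/`
(`perm.theorems-prover-only`); landed by the prover ns-es-p1 g5 as landing hand of record (director-ns DIRECTOR-NS #237 (3)), split into
≤ 400-line modules, `E3` spelled out, the artefact's `#guard_msgs … #print axioms` certificates not landed.
`--supports stmt-NavierStokesRegularity-23843 --as helper`.

HONEST FRAMING: instrument theorems about HYPOTHETICAL Type-I zoom limits (Albritton–Barker objects of the census of crux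
`TypeIQuarterGate.ScarEnvelopeTypeI`, item 23843); the analytic input is the tree's closure engine (compactness
`local_typeI_compactness_twin_inBall`, sharpened to constant 1 in Part S1; Q1 whole-space), P1 rate inheritance, L8 persistence and the
tree's PROVED small-constant Liouville theorem; Parts R/S are order theory on the re-classing and closure lemmas.  NOTHING OPEN IS
PROVED: 23843, (L′) `TypeILiouvilleAB` / (L′₀), the GLOBAL (S∞) = `CritAttained`, (M𝐈₁), (E1⁺), (E2ᵣ), route ExtremalTypeIConstant's
cruxes, N0 and Navier–Stokes regularity are OPEN; `critRate`, `levelCrit I`, `liouvilleRate` are `sInf`s that are `0` by junk value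
when the defining set is empty (every statement using them carries the nonemptiness hypothesis explicitly).
-/

-- the summit-side namespace repeats a component by design (single-conjunct summit, D-0017)
set_option linter.dupNamespace false

open MeasureTheory Set Metric Filter Topology
open scoped ENNReal NNReal InnerProductSpace
open Literature.Analysis.FluidPDE

namespace Summit.NavierStokesRegularity.NavierStokesRegularity.Cruxes.ScarEnvelopeTypeI.ZoomDictionary

section EnergySaturation

variable {U : ℝ → (EuclideanSpace ℝ (Fin 3)) → (EuclideanSpace ℝ (Fin 3))} {P : ℝ → (EuclideanSpace ℝ (Fin 3)) → ℝ}

/-- ★★ **V0. SEQUENCE CLOSURE WITH THE CYLINDER-LEVEL EVENTUAL-BOUND CLAUSE.**  T1 (`abSeq_closed'`)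
with the energy clause of T0 exported RAW: `𝐈(limit) ≤ I'` for every `I'` that EVENTUALLY bounds the
approximants' Type-I energies on the INITIAL SEGMENTS OF CYLINDERS `Q_{2^m}(0)`, `m ≤ k` (not only on the
whole slab) — the form needed when the approximants are ZOOMS, whose slab energies are scale-invariant but
whose cylinder energies see only a small neighbourhood of the point zoomed at. -/
theorem abSeq_closed'' {Ms : ℕ → ℝ} {Minf : ℝ} {I : ℝ≥0∞} (hI : I < ⊤)
    (v : ℕ → ℝ → (EuclideanSpace ℝ (Fin 3)) → (EuclideanSpace ℝ (Fin 3))) (q : ℕ → ℝ → (EuclideanSpace ℝ (Fin 3)) → ℝ) (Gz : ℕ → ℝ → (EuclideanSpace ℝ (Fin 3)) → (EuclideanSpace ℝ (Fin 3)) →L[ℝ] (EuclideanSpace ℝ (Fin 3)))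
    (hAB : ∀ k, ABTower (Ms k) (v k) (q k) (Gz k))
    (hbd : ∀ k, typeIBound (Iio (0 : ℝ) ×ˢ univ) (v k) (q k) (Gz k) ≤ I)
    (hM : Tendsto Ms atTop (𝓝 Minf)) :
    ∃ (U' : ℝ → (EuclideanSpace ℝ (Fin 3)) → (EuclideanSpace ℝ (Fin 3))) (P' : ℝ → (EuclideanSpace ℝ (Fin 3)) → ℝ) (H' : ℝ → (EuclideanSpace ℝ (Fin 3)) → (EuclideanSpace ℝ (Fin 3)) →L[ℝ] (EuclideanSpace ℝ (Fin 3))) (σ : ℕ → ℕ),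
      StrictMono σ ∧ ABTower Minf U' P' H' ∧ typeIBound (Iio (0 : ℝ) ×ˢ univ) U' P' H' ≤ I ∧
      (∀ I' : ℝ≥0∞, (∀ᶠ k in atTop, ∀ m : ℕ, m ≤ k →
          typeIBound (parabolicCylinder ((2 : ℝ) ^ m) (0 : ℝ × (EuclideanSpace ℝ (Fin 3)))) (v k) (q k) (Gz k) ≤ I') →
        typeIBound (Iio (0 : ℝ) ×ˢ univ) U' P' H' ≤ I') ∧
      (∀ R : ℝ, 0 < R → MemLp (Function.uncurry U') 3
        (volume.restrict (parabolicCylinder R (0 : ℝ × (EuclideanSpace ℝ (Fin 3)))))) ∧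
      (∀ R : ℝ, 0 < R → Tendsto (fun j => eLpNorm
        (Function.uncurry (v (σ j)) - Function.uncurry U') 3
        (volume.restrict (parabolicCylinder R (0 : ℝ × (EuclideanSpace ℝ (Fin 3)))))) atTop (𝓝 0)) ∧
      ((∀ k, ¬ RegPt (v k) 0) → ¬ RegPt U' 0) := by
  have hcc_pos : ∀ m : ℕ, (0 : ℝ) < (2 : ℝ) ^ m := fun m => by positivity
  have hballs : ∀ m k : ℕ, IsSuitableWeakSolutionInBall ((2 : ℝ) ^ m) (0 : ℝ × (EuclideanSpace ℝ (Fin 3))) (v k) (q k) :=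
    fun m k => (hAB k).2.1 _ (hcc_pos m)
  have hQsl : ∀ ρ : ℝ, (parabolicCylinderOpens ρ (0 : ℝ × (EuclideanSpace ℝ (Fin 3))) : TopologicalSpace.Opens (ℝ × (EuclideanSpace ℝ (Fin 3)))) ≤
      slab (EuclideanSpace ℝ (Fin 3)) (Iio 0) isOpen_Iio := fun ρ w hw => parabolicCylinder_origin_subset_slab ρ hw
  have hgrads : ∀ m k : ℕ,
      HasWeakSpatialGradientOn (parabolicCylinderOpens ((2 : ℝ) ^ m) (0 : ℝ × (EuclideanSpace ℝ (Fin 3)))) (v k) (Gz k) :=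
    fun m k => (hAB k).2.2.1.mono (hQsl _)
  have hIs : ∀ m k : ℕ,
      typeIBound (parabolicCylinder ((2 : ℝ) ^ m) (0 : ℝ × (EuclideanSpace ℝ (Fin 3)))) (v k) (q k) (Gz k) ≤ I :=
    fun m k => (typeIBound_mono (parabolicCylinder_origin_subset_slab _)).trans (hbd k)
  -- ## compactness with the liminf energy clause (T0)
  obtain ⟨Ut, Pt, Ht, σ, hσ, hIBU, hswU, hHU, h4, hmemU, hconvU, hpers⟩ :=
    Summit.NavierStokesRegularity.NavierStokesRegularity.Cruxes.ScarEnvelopeTypeI.SliceBudget.local_typeI_compactness_twin_inBall_evt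
      I v q Gz hI (fun m k _ => hballs m k) (fun m k _ => hgrads m k) (fun m k _ => hIs m k)
  have h4I : typeIBound (Iio (0 : ℝ) ×ˢ univ) Ut Pt Ht ≤ I :=
    h4 I (Eventually.of_forall fun k m _ => hIs m k)
  -- ## nonnegativity of the classes and of the limit class
  have hMk : ∀ k, 0 ≤ Ms k := fun k => by
    have h := (hAB k).1.2.2.2 (-1) (by norm_num) 0
    rw [neg_neg, Real.sqrt_one, div_one] at h
    exact (norm_nonneg _).trans h
  have hMinf : 0 ≤ Minf := ge_of_tendsto' hM hMk
  -- ## the rate `M_∞/√(−t)` of the limit, a.e.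
  have hrate_ae : ∀ᵐ w ∂(volume.restrict (Iio (0 : ℝ) ×ˢ (univ : Set (EuclideanSpace ℝ (Fin 3))))),
      ‖Ut w.1 w.2‖ ≤ Minf / Real.sqrt (-w.1) := by
    have hQ : ∀ m : ℕ, ∀ᵐ w ∂(volume.restrict (parabolicCylinder ((2 : ℝ) ^ m) (0 : ℝ × (EuclideanSpace ℝ (Fin 3))))),
        ‖Ut w.1 w.2‖ ≤ Minf / Real.sqrt (-w.1) := by
      intro m
      have hmeas : ∀ j, AEStronglyMeasurable (Function.uncurry (v (σ j)))
          (volume.restrict (parabolicCylinder ((2 : ℝ) ^ m) (0 : ℝ × (EuclideanSpace ℝ (Fin 3))))) := fun j =>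
        (hballs m (σ j)).1.distributional.1.aestronglyMeasurable
      obtain ⟨ψ, hψ, hae⟩ := exists_subseq_tendsto_ae₃ hmeas (hmemU _ (hcc_pos m)).1
        (hconvU _ (hcc_pos m))
      filter_upwards [hae, ae_restrict_mem (isOpen_parabolicCylinder _ _).measurableSet]
        with w hw hwmem
      have hw0 : w.1 < 0 := by
        have h1 := ((mem_parabolicCylinder).1 hwmem).1.2
        simpa using h1
      have hlim : Tendsto (fun i => Ms (σ (ψ i)) / Real.sqrt (-w.1)) atTop
          (𝓝 (Minf / Real.sqrt (-w.1))) :=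
        ((hM.comp hσ.tendsto_atTop).comp hψ.tendsto_atTop).div_const _
      exact le_of_tendsto_of_tendsto hw.norm hlim
        (Eventually.of_forall fun i => (hAB (σ (ψ i))).1.2.2.2 _ hw0 _)
    have hcover : (Iio (0 : ℝ) ×ˢ (univ : Set (EuclideanSpace ℝ (Fin 3)))) ⊆
        ⋃ m : ℕ, parabolicCylinder ((2 : ℝ) ^ m) (0 : ℝ × (EuclideanSpace ℝ (Fin 3))) := by
      rintro ⟨t, x⟩ ⟨ht', -⟩
      obtain ⟨m, hm⟩ := exists_mem_parabolicCylinder_two_pow₃ (mem_Iio.1 ht') x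
      exact mem_iUnion.2 ⟨m, hm⟩
    exact ae_restrict_of_ae_restrict_of_subset hcover ((ae_restrict_iUnion_iff _ _).2 hQ)
  -- ## representatives: the rate everywhere, then continuous Oseen-mild (KNSS)
  obtain ⟨U₁, hae₁, hdec₁⟩ := exists_repr_hasTypeITimeDecay hMinf hrate_ae
  have hae₁' : ∀ᵐ w ∂(volume.restrict ((slab (EuclideanSpace ℝ (Fin 3)) (Iio 0) isOpen_Iio :
      TopologicalSpace.Opens (ℝ × (EuclideanSpace ℝ (Fin 3)))) : Set (ℝ × (EuclideanSpace ℝ (Fin 3))))),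
      Function.uncurry Ut w = Function.uncurry U₁ w := by
    rw [coe_slab]
    exact hae₁
  have hsw₁ : IsSuitableWeakSolutionOn (slab (EuclideanSpace ℝ (Fin 3)) (Iio 0) isOpen_Iio) 1 0 U₁ Pt :=
    hswU.congr_ae hae₁' (ae_of_all _ fun _ => rfl)
  have hI₁ : typeIBound (Iio (0 : ℝ) ×ˢ univ) U₁ Pt Ht < ⊤ := by
    rw [← typeIBound_congr_ae hae₁]
    exact lt_of_le_of_lt h4I hI
  obtain ⟨U', hae₂, hUc, hUdiv, hUmild, hUrate⟩ :=
    exists_oseenMild_repr_of_typeIBound_lt_top hsw₁ hdec₁ hI₁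
  have hae : ∀ᵐ w ∂(volume.restrict (Iio (0 : ℝ) ×ˢ (univ : Set (EuclideanSpace ℝ (Fin 3))))),
      Function.uncurry Ut w = Function.uncurry U' w := by
    filter_upwards [hae₁, hae₂] with w h1 h2
    rw [h1, h2]
  have hae' : ∀ᵐ w ∂(volume.restrict ((slab (EuclideanSpace ℝ (Fin 3)) (Iio 0) isOpen_Iio :
      TopologicalSpace.Opens (ℝ × (EuclideanSpace ℝ (Fin 3)))) : Set (ℝ × (EuclideanSpace ℝ (Fin 3))))),
      Function.uncurry Ut w = Function.uncurry U' w := by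
    rw [coe_slab]
    exact hae
  have hTI : IsTypeIAncientMild Minf U' :=
    LocalTypeIBlowup.isTypeIAncientMild_of_continuous_oseenMild_rate hUc hUdiv hUmild hUrate
  have hIBU' : ∀ a : ℝ, 0 < a → IsSuitableWeakSolutionInBall a (0 : ℝ × (EuclideanSpace ℝ (Fin 3))) U' Pt := fun a ha =>
    (hIBU a ha).congr_ae'
      (ae_restrict_of_ae_restrict_of_subset (parabolicCylinder_origin_subset_slab a) hae)
      (ae_of_all _ fun _ => rfl)
  have hHU' : HasWeakSpatialGradientOn (slab (EuclideanSpace ℝ (Fin 3)) (Iio 0) isOpen_Iio) U' Ht := hHU.congr_ae hae'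
  have hIU'le : typeIBound (Iio (0 : ℝ) ×ˢ univ) U' Pt Ht ≤ I := by
    rw [← typeIBound_congr_ae hae]
    exact h4I
  have hIU' : typeIBound (Iio (0 : ℝ) ×ˢ univ) U' Pt Ht < ⊤ := lt_of_le_of_lt hIU'le hI
  refine ⟨U', Pt, Ht, σ, hσ, ⟨hTI, hIBU', hHU', hIU'⟩, hIU'le, fun I' hI' => ?_, fun R hR => ?_,
    fun R hR => ?_, fun hsing => ?_⟩
  · -- the cylinder-level eventual-bound clause survives the change of representative
    rw [← typeIBound_congr_ae hae]
    exact h4 I' hI'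
  · -- `U' ∈ L³(Q_R(0))` for every `R > 0`
    exact (hmemU R hR).ae_eq
      (ae_restrict_of_ae_restrict_of_subset (parabolicCylinder_origin_subset_slab R) hae)
  · -- `L³_loc` convergence along `σ` to the representative
    have haeR : ∀ᵐ w ∂(volume.restrict (parabolicCylinder R (0 : ℝ × (EuclideanSpace ℝ (Fin 3))))),
        Function.uncurry Ut w = Function.uncurry U' w :=
      ae_restrict_of_ae_restrict_of_subset (parabolicCylinder_origin_subset_slab R) hae
    refine (hconvU R hR).congr' (Eventually.of_forall fun j => ?_)
    exact eLpNorm_congr_ae (haeR.mono fun w hw => by simp only [Pi.sub_apply, hw])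
  · -- ## the origin stays singular
    have hsingU : IsBackwardSingularPoint Ut (0 : ℝ × (EuclideanSpace ℝ (Fin 3))) := by
      refine hpers 0 (by simp) fun R hR => ?_
      have hc : ∀ j, eLpNorm (Function.uncurry (v (σ j))) ⊤
          (volume.restrict (parabolicCylinder R (0 : ℝ × (EuclideanSpace ℝ (Fin 3))))) = ⊤ := fun j =>
        eLpNorm_top_eq_top_of_not_regPt (hsing _) hR.1
      simp only [hc, Filter.limsup_const]
    intro hr
    apply not_regPt_zero_of_isBackwardSingularPoint hsingU
    have haeR : ∀ R ∈ Ioo (0 : ℝ) 1,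
        ∀ᵐ z ∂(volume.restrict (parabolicCylinder R (0 : ℝ × (EuclideanSpace ℝ (Fin 3))))), Ut z.1 z.2 = U' z.1 z.2 :=
      fun R _ => (ae_restrict_of_ae_restrict_of_subset (parabolicCylinder_origin_subset_slab R)
        hae).mono fun w hw => hw
    exact (regPt_iff_of_ae_eq_of_norm_lt_one haeR (by simp)).2 hr

/-! ### V1. Energy near a scar of an exactly-critical object -/

/-- ★★★ **V1. THE ENERGY NEAR EVERY SCAR OF AN EXACTLY-CRITICAL OBJECT IS AT LEAST THE MINIMAL LEVEL.**
For `n` exactly critical at the level `I` (class `M_c(I)`, `𝐈(n) ≤ I`, singular root) and ANY scar `y'` of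
`n.U`, every backward parabolic neighbourhood `Q_ρ((0, y'))` has `𝐈(Q_ρ((0, y'))) ≥ minLevel I`. -/
theorem ExactCrit.minLevel_le_local {I : ℝ≥0∞} {n : TNode} (h : ExactCrit I n) {y' : (EuclideanSpace ℝ (Fin 3))}
    (hy : ¬ RegPt n.U y') {ρ : ℝ} (hρ : 0 < ρ) :
    minLevel I ≤ typeIBound (parabolicCylinder ρ (((0 : ℝ), y') : ℝ × (EuclideanSpace ℝ (Fin 3)))) n.U n.P n.H := by
  have hT : ABTower (levelCrit I) n.U n.P n.H := h.1.1
  have hI₀ : n.level < ⊤ := hT.2.2.2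
  -- the scales `L k = ρ / 2^(k+1)`
  obtain ⟨L, hL⟩ : ∃ L : ℕ → ℝ, ∀ k, L k = ρ / 2 ^ (k + 1) := ⟨fun k => ρ / 2 ^ (k + 1), fun _ => rfl⟩
  have hLpos : ∀ k, 0 < L k := fun k => by rw [hL k]; positivity
  have hLle : ∀ k m : ℕ, m ≤ k → (2 : ℝ) ^ m * L k ≤ ρ := by
    intro k m hmk
    have h2 : (2 : ℝ) ^ m ≤ 2 ^ (k + 1) := pow_le_pow_right₀ (by norm_num) (by omega)
    have hk1 : (0 : ℝ) < 2 ^ (k + 1) := by positivity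
    rw [hL k, mul_div_assoc', div_le_iff₀ hk1]
    nlinarith
  -- the zooms about `(0, y')`: A–B objects of the same class and the same level
  have hABk : ∀ k, ABTower (levelCrit I) (zoom n.U y' 0 (L k)) (zoomP n.P y' 0 (L k))
      (L k ^ 2 • stPull (L k ^ 2) (L k) (0 : ℝ) y' n.H) := fun k => by
    rw [zoom_eq_smul_stPull, zoomP_eq_smul_stPull]
    exact abTower_zoom hT y' (hLpos k)
  have hbdk : ∀ k, typeIBound (Iio (0 : ℝ) ×ˢ univ) (zoom n.U y' 0 (L k)) (zoomP n.P y' 0 (L k))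
      (L k ^ 2 • stPull (L k ^ 2) (L k) (0 : ℝ) y' n.H) ≤ n.level := by
    intro k
    show _ ≤ typeIBound (Iio (0 : ℝ) ×ˢ univ) n.U n.P n.H
    rw [zoom_eq_smul_stPull, zoomP_eq_smul_stPull,
      ← typeIBound_nsZoom (hLpos k) (0 : ℝ) y' (Iio (0 : ℝ) ×ˢ univ) n.U n.P n.H,
      stAffine_preimage_lowerSlab (hLpos k) y']
  -- the energies of the `k`-th zoom on `Q_{2^m}(0)`, `m ≤ k`, are energies of `n` inside `Q_ρ((0, y'))`
  have hcyl : ∀ k m : ℕ, m ≤ k →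
      typeIBound (parabolicCylinder ((2 : ℝ) ^ m) (0 : ℝ × (EuclideanSpace ℝ (Fin 3)))) (zoom n.U y' 0 (L k))
        (zoomP n.P y' 0 (L k)) (L k ^ 2 • stPull (L k ^ 2) (L k) (0 : ℝ) y' n.H) ≤
      typeIBound (parabolicCylinder ρ (((0 : ℝ), y') : ℝ × (EuclideanSpace ℝ (Fin 3)))) n.U n.P n.H := by
    intro k m hmk
    have hpre : stAffine (L k ^ 2) (L k) (0 : ℝ) y' ⁻¹'
        parabolicCylinder ((2 : ℝ) ^ m * L k) (((0 : ℝ), y') : ℝ × (EuclideanSpace ℝ (Fin 3))) =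
        parabolicCylinder ((2 : ℝ) ^ m * L k / L k) (0 : ℝ × (EuclideanSpace ℝ (Fin 3))) :=
      zoom_preimage_parabolicCylinder (hLpos k) (((0 : ℝ), y') : ℝ × (EuclideanSpace ℝ (Fin 3))) _
    rw [mul_div_cancel_right₀ _ (hLpos k).ne'] at hpre
    rw [zoom_eq_smul_stPull, zoomP_eq_smul_stPull, ← hpre,
      typeIBound_nsZoom (hLpos k) (0 : ℝ) y' _ n.U n.P n.H]
    exact typeIBound_mono (Floor.cyl_mono (hLle k m hmk) (mul_pos (pow_pos two_pos m) (hLpos k)).le _)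
  -- V0 along the zooms (constant class)
  obtain ⟨U', P', H', σ, -, hT', hI', hcl, -, -, hpers⟩ :=
    abSeq_closed'' hI₀ _ _ _ hABk hbdk (tendsto_const_nhds (x := levelCrit I))
  -- the limit is exactly critical at the level `I`
  have hsing : ¬ RegPt U' 0 := hpers fun k hk => hy (regPt_of_regPt_zoom_zero (hLpos k) hk)
  have hE' : ExactCrit I ⟨U', P', H', 0⟩ := ⟨⟨hT', hsing⟩, hI'.trans h.2⟩
  calc minLevel I ≤ TNode.level ⟨U', P', H', 0⟩ := minLevel_le hE'
    _ ≤ typeIBound (parabolicCylinder ρ (((0 : ℝ), y') : ℝ × (EuclideanSpace ℝ (Fin 3)))) n.U n.P n.H :=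
        hcl _ (Eventually.of_forall fun k m hmk => hcyl k m hmk)

/-- V1 at the root. -/
theorem ExactCrit.minLevel_le_root {I : ℝ≥0∞} {n : TNode} (h : ExactCrit I n) {ρ : ℝ} (hρ : 0 < ρ) :
    minLevel I ≤ typeIBound (parabolicCylinder ρ (0 : ℝ × (EuclideanSpace ℝ (Fin 3)))) n.U n.P n.H := by
  have h1 := h.minLevel_le_local h.1.2 hρ
  rwa [Prod.mk_zero_zero] at h1

/-! ### V2. Energy saturation for doubly-minimal objects -/

/-- ★★★ **V2. ENERGY SATURATION.**  For a DOUBLY-MINIMAL object of the level `I` (exactly critical AND of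
minimal energy `𝐈 = minLevel I`), the Type-I energy of EVERY backward parabolic neighbourhood of EVERY
scar EQUALS the whole energy: `𝐈(Q_ρ((0, y'))) = 𝐈(ℝ³ × ℝ₋) = minLevel I` for every scar `y'` and every
`ρ > 0`.  Nothing of the energy lives away from any scar, at any scale. -/
theorem DoublyMin.energy_local_eq {I : ℝ≥0∞} {n : TNode} (h : DoublyMin I n) {y' : (EuclideanSpace ℝ (Fin 3))}
    (hy : ¬ RegPt n.U y') {ρ : ℝ} (hρ : 0 < ρ) :
    typeIBound (parabolicCylinder ρ (((0 : ℝ), y') : ℝ × (EuclideanSpace ℝ (Fin 3)))) n.U n.P n.H = minLevel I :=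
  le_antisymm ((typeIBound_mono (parabolicCylinder_subset_lowerHalf ρ y')).trans h.2.le)
    (h.1.minLevel_le_local hy hρ)

/-- V2 at the root: `𝐈(Q_ρ(0)) = 𝐈 = minLevel I` for every `ρ > 0`. -/
theorem DoublyMin.energy_root_eq {I : ℝ≥0∞} {n : TNode} (h : DoublyMin I n) {ρ : ℝ} (hρ : 0 < ρ) :
    typeIBound (parabolicCylinder ρ (0 : ℝ × (EuclideanSpace ℝ (Fin 3)))) n.U n.P n.H = minLevel I := by
  have h1 := h.energy_local_eq h.1.1.2 hρ
  rwa [Prod.mk_zero_zero] at h1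

/-- V2, local = global: the energy of every scar neighbourhood is the energy of the whole flow. -/
theorem DoublyMin.energy_local_eq_level {I : ℝ≥0∞} {n : TNode} (h : DoublyMin I n) {y' : (EuclideanSpace ℝ (Fin 3))}
    (hy : ¬ RegPt n.U y') {ρ : ℝ} (hρ : 0 < ρ) :
    typeIBound (parabolicCylinder ρ (((0 : ℝ), y') : ℝ × (EuclideanSpace ℝ (Fin 3)))) n.U n.P n.H = n.level := by
  rw [h.energy_local_eq hy hρ, h.2]

/-- V2c. THE SUP IS REALISED AT EVERY SCAR AT EVERY SCALE: for every scar `y'`, every `ρ > 0` and every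
`J < 𝐈(n)` there is a parabolic ball `Q_r(z) ⊆ Q_ρ((0, y'))` with `(A + C + D + E)(Q_r(z)) > J`. -/
theorem DoublyMin.exists_cylinder {I : ℝ≥0∞} {n : TNode} (h : DoublyMin I n) {y' : (EuclideanSpace ℝ (Fin 3))}
    (hy : ¬ RegPt n.U y') {ρ : ℝ} (hρ : 0 < ρ) {J : ℝ≥0∞} (hJ : J < n.level) :
    ∃ r : ℝ, 0 < r ∧ ∃ z : ℝ × (EuclideanSpace ℝ (Fin 3)), parabolicCylinder r z ⊆ parabolicCylinder ρ (((0 : ℝ), y') : ℝ × (EuclideanSpace ℝ (Fin 3))) ∧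
      J < abScaledSum r z n.U n.P n.H := by
  rw [← h.energy_local_eq_level hy hρ, typeIBound] at hJ
  simp only [lt_iSup_iff] at hJ
  obtain ⟨r, hr, z, hz, hlt⟩ := hJ
  exact ⟨r, hr, z, hz, hlt⟩

end EnergySaturation

end Summit.NavierStokesRegularity.NavierStokesRegularity.Cruxes.ScarEnvelopeTypeI.ZoomDictionary
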